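import Summits.Ventures.CertifiedManyBodySolver.Theorems.TcThermcert1CorridorTransferDiscs
import Mathlib
import HarnessLib

/-!
# Corridor transfer, part 2: two admissible functions with matching `L`-jets at `0` have close logarithms at `b`

Helper file (part 2 of 2) for route `TcThermcert1`, crux `ThermalStiffnessCeilingU8b10_le_1o8`
(item `stmt-Ventures-26381`), line `Cruxes/ThermalStiffnessCeilingU8b10_le_1o8/Lines/zerofree_corridor.lean`:
it proves the registered stub `stub_corridorTransfer` of that line in structure-free form (the line's
`CorridorData η b M f` is the conjunction of the four hypotheses `DifferentiableOn … / ≠ 0 / ‖·‖ ≤ e^M /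
real ≥ e^{−M} on the axis` below, and its `corridor η b` is the literal set
`{z : ℂ | -η < z.re ∧ z.re < b + η ∧ |z.im| < η}`), so the stub follows from `corridorTransfer` by projecting
the structure fields.

**Statement (`corridorTransfer`).** For `η, b > 0` there are `C > 0` and `0 ≤ r < 1` (depending on `η, b`
only) such that for every `L : ℕ`, `M ≥ 0` and `f, g` holomorphic and zero-free on the corridor with
`‖f‖, ‖g‖ ≤ e^M` there, real with real part `≥ e^{−M}` on the real segment `(−η, b+η)`, and
`f^{(k)}(0) = g^{(k)}(0)` for `k < L`, one has `|log f(b) − log g(b)| ≤ C (M+1) r^L`.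

**Proof** (part 1 = `TcThermcert1CorridorTransferDiscs.lean` supplies the disc tools). With the holomorphic
logarithms `ℓ_f, ℓ_g` of part 1 §4 put `h := ℓ_f − ℓ_g`.  §5: at every real centre `c ∈ [0,b]` the disc
`ball c (η/2)` lies in the corridor and Borel–Carathéodory gives `‖h^{(k)}(c)‖ ≤ k!·8M/(η/2)^k` for all `k`;
the jets give `h^{(k)}(0) = 0` for `k < L` (part 1 §3); a fixed chain of `n = ⌈8b/η⌉` discs with real centres
`j·b/n` then carries the bound `3·5^j·8M·2^{−⌊L/2^j⌋}` from `j = 0` (where it is the two-radii estimate with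
`ε = 0`) to `j = n`, each step being the two-radii estimate of part 1 §2 with `N = ⌊L/2^{j+1}⌋`.  §6: at `b = n·(b/n)`
this reads `|h(b)| ≤ 24·5^n·M·2^{−⌊L/2^n⌋} ≤ 48·5^n·M·r^L` with `r = 2^{−2^{−n}}`, realised as the `n`-fold square
root of `1/2` (so `r^{2^n} = 1/2`, no real powers needed); `C = 48·5^n`.

No definitions; all statements proved. [folklore] complex analysis (Borel–Carathéodory + Taylor two-radii chain, a
Hadamard three-circles substitute); the constants are not optimised.
-/

noncomputable section

open Complex Metric Set Filter Topology Finset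

namespace Summit.Ventures.CertifiedManyBodySolver.Theorems.TcThermcert1.ZeroFreeCorridor

/-! ## §5 Coefficient bounds for `h = ℓ_f − ℓ_g` at real centres; the disc chain -/

/-- Discs of radius `η/2` with real centre in `[0, b]` lie in the corridor. -/
theorem ball_subset_corridor {η b : ℝ} {U : Set ℂ}
    (hU : U = {z : ℂ | -η < z.re ∧ z.re < b + η ∧ |z.im| < η}) (hη : 0 < η) {c : ℝ} (hc0 : 0 ≤ c)
    (hcb : c ≤ b) : ball (c : ℂ) (η / 2) ⊆ U := by
  intro z hz
  rw [mem_ball, dist_eq_norm] at hz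
  have h1 : |(z - c).re| < η / 2 := lt_of_le_of_lt (abs_re_le_norm _) hz
  have h2 : |(z - c).im| < η / 2 := lt_of_le_of_lt (abs_im_le_norm _) hz
  simp only [sub_re, ofReal_re, sub_im, ofReal_im, sub_zero] at h1 h2
  rw [abs_lt] at h1
  rw [hU]
  simp only [mem_setOf_eq]
  exact ⟨by linarith [h1.1], by linarith [h1.2], by linarith⟩

/-- Coefficient bounds at a real centre `c ∈ [0, b]` for the difference `h = ℓ_f − ℓ_g` of two logarithms with
`Re ℓ ≤ M` on the corridor and `ℓ(x)` real with `Re ℓ(x) ≥ −M` on `[0, b]`: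
`‖h^{(k)}(c)‖ ≤ k!·8M/(η/2)^k` for every `k` (Borel–Carathéodory for `k ≥ 1`, directly for `k = 0`). -/
theorem coeff_bounds_sub_log {ℓf ℓg : ℂ → ℂ} {U : Set ℂ} {η b M : ℝ}
    (hU : U = {z : ℂ | -η < z.re ∧ z.re < b + η ∧ |z.im| < η}) (hη : 0 < η) (hM : 0 ≤ M)
    (hℓfd : DifferentiableOn ℂ ℓf U) (hℓgd : DifferentiableOn ℂ ℓg U)
    (hℓfM : ∀ z ∈ U, (ℓf z).re ≤ M) (hℓgM : ∀ z ∈ U, (ℓg z).re ≤ M)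
    (hℓfax : ∀ x : ℝ, 0 ≤ x → x ≤ b → (ℓf x).im = 0 ∧ -M ≤ (ℓf x).re)
    (hℓgax : ∀ x : ℝ, 0 ≤ x → x ≤ b → (ℓg x).im = 0 ∧ -M ≤ (ℓg x).re)
    {c : ℝ} (hc0 : 0 ≤ c) (hcb : c ≤ b) :
    DifferentiableOn ℂ (ℓf - ℓg) (ball (c : ℂ) (η / 2)) ∧
      ∀ k : ℕ, ‖iteratedDeriv k (ℓf - ℓg) c‖ ≤ k.factorial * (8 * M) / (η / 2) ^ k := by
  have hsub := ball_subset_corridor hU hη hc0 hcb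
  have hR : 0 < η / 2 := by positivity
  have hfd := hℓfd.mono hsub
  have hgd := hℓgd.mono hsub
  refine ⟨hfd.sub hgd, fun k => ?_⟩
  have hcU : (c : ℂ) ∈ U := hsub (mem_ball_self hR)
  obtain ⟨hfi, hfr⟩ := hℓfax c hc0 hcb
  obtain ⟨hgi, hgr⟩ := hℓgax c hc0 hcb
  have hfr' := hℓfM c hcU
  have hgr' := hℓgM c hcU
  rcases Nat.eq_zero_or_pos k with rfl | hk
  · have hval : (ℓf - ℓg) (c : ℂ) = (((ℓf c).re - (ℓg c).re : ℝ) : ℂ) := by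
      apply Complex.ext <;> simp [hfi, hgi]
    simp only [iteratedDeriv_zero, Nat.factorial_zero, Nat.cast_one, one_mul, pow_zero, div_one, hval,
      Complex.norm_real, Real.norm_eq_abs]
    rw [abs_le]
    constructor <;> linarith
  · have hfa : AnalyticAt ℂ ℓf c := hfd.analyticAt (ball_mem_nhds _ hR)
    have hga : AnalyticAt ℂ ℓg c := hgd.analyticAt (ball_mem_nhds _ hR)
    rw [iteratedDeriv_sub hfa.contDiffAt hga.contDiffAt]
    have h1 := norm_iteratedDeriv_le_of_re_le hR hfd (fun z hz => hℓfM z (hsub hz)) hk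
    have h2 := norm_iteratedDeriv_le_of_re_le hR hgd (fun z hz => hℓgM z (hsub hz)) hk
    have hfac : (0 : ℝ) ≤ 2 * k.factorial := by positivity
    have hRk : (0 : ℝ) < (η / 2) ^ k := pow_pos hR k
    have ha : 2 * (k.factorial : ℝ) * (M - (ℓf c).re) ≤ 2 * k.factorial * (2 * M) :=
      mul_le_mul_of_nonneg_left (by linarith) hfac
    have hb' : 2 * (k.factorial : ℝ) * (M - (ℓg c).re) ≤ 2 * k.factorial * (2 * M) :=
      mul_le_mul_of_nonneg_left (by linarith) hfac
    calc ‖iteratedDeriv k ℓf c - iteratedDeriv k ℓg c‖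
        ≤ ‖iteratedDeriv k ℓf c‖ + ‖iteratedDeriv k ℓg c‖ := norm_sub_le _ _
      _ ≤ 2 * k.factorial * (M - (ℓf c).re) / (η / 2) ^ k +
            2 * k.factorial * (M - (ℓg c).re) / (η / 2) ^ k := add_le_add h1 h2
      _ ≤ 2 * k.factorial * (2 * M) / (η / 2) ^ k + 2 * k.factorial * (2 * M) / (η / 2) ^ k :=
          add_le_add (div_le_div_of_nonneg_right ha hRk.le) (div_le_div_of_nonneg_right hb' hRk.le)
      _ = k.factorial * (8 * M) / (η / 2) ^ k := by ring

/-- Arithmetic of one chain step: with `2N ≤ e`,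
`4·(3·5^j·A·2^{−e})·2^N + 2A·2^{−N} ≤ 3·5^{j+1}·A·2^{−N}`. -/
theorem chain_step_arith {A : ℝ} (hA : 0 ≤ A) (j e N : ℕ) (hN : 2 * N ≤ e) :
    4 * (3 * 5 ^ j * A * (1 / 2 : ℝ) ^ e) * 2 ^ N + 2 * A * (1 / 2) ^ N ≤
      3 * 5 ^ (j + 1) * A * (1 / 2) ^ N := by
  have hx : (0 : ℝ) < (1 / 2 : ℝ) ^ N := by positivity
  have hP : (1 : ℝ) ≤ 5 ^ j := one_le_pow₀ (by norm_num)
  have h1 : (1 / 2 : ℝ) ^ e ≤ (1 / 2) ^ (2 * N) :=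
    pow_le_pow_of_le_one (by norm_num) (by norm_num) hN
  have h2 : (1 / 2 : ℝ) ^ (2 * N) * 2 ^ N = (1 / 2) ^ N := by
    rw [pow_mul, ← mul_pow]
    norm_num
  have hAx : 0 ≤ A * (1 / 2 : ℝ) ^ N := mul_nonneg hA hx.le
  have h3 : A * (1 / 2 : ℝ) ^ N * 1 ≤ A * (1 / 2) ^ N * 5 ^ j := mul_le_mul_of_nonneg_left hP hAx
  have h5A : (0 : ℝ) ≤ 4 * (3 * 5 ^ j * A) * 2 ^ N := by positivity
  calc 4 * (3 * 5 ^ j * A * (1 / 2 : ℝ) ^ e) * 2 ^ N + 2 * A * (1 / 2) ^ N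
      = 4 * (3 * 5 ^ j * A) * 2 ^ N * (1 / 2 : ℝ) ^ e + 2 * A * (1 / 2) ^ N := by ring
    _ ≤ 4 * (3 * 5 ^ j * A) * 2 ^ N * (1 / 2 : ℝ) ^ (2 * N) + 2 * A * (1 / 2) ^ N := by
        have := mul_le_mul_of_nonneg_left h1 h5A
        linarith
    _ = 12 * 5 ^ j * A * ((1 / 2 : ℝ) ^ (2 * N) * 2 ^ N) + 2 * A * (1 / 2) ^ N := by ring
    _ = 12 * 5 ^ j * A * (1 / 2) ^ N + 2 * A * (1 / 2) ^ N := by rw [h2]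
    _ ≤ 12 * 5 ^ j * A * (1 / 2) ^ N + 3 * 5 ^ j * A * (1 / 2) ^ N := by nlinarith [h3, hAx]
    _ = 3 * 5 ^ (j + 1) * A * (1 / 2) ^ N := by ring

/-- The disc chain: `h` holomorphic on the discs `ball (j s) R`, `j ≤ n`, with the uniform coefficient bound
`‖h^{(k)}(j s)‖ ≤ k!·A/R^k`, step `0 ≤ s ≤ R/4`, and `h^{(k)}(0) = 0` for `k < L`
`⇒ ‖h‖ ≤ 3·5^j·A·2^{−⌊L/2^j⌋}` on `closedBall (j s) (R/2)` for every `j ≤ n` (induction on `j`, each step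
`norm_le_two_radii` with `N = ⌊L/2^{j+1}⌋`). -/
theorem chain_bound {h : ℂ → ℂ} {R s A : ℝ} {L n : ℕ} (hR : 0 < R) (hs0 : 0 ≤ s) (hs : s ≤ R / 4)
    (hA : 0 ≤ A)
    (hdiff : ∀ j : ℕ, j ≤ n → DifferentiableOn ℂ h (ball (((j : ℝ) * s : ℝ) : ℂ) R))
    (hbig : ∀ j : ℕ, j ≤ n → ∀ k : ℕ,
      ‖iteratedDeriv k h (((j : ℝ) * s : ℝ) : ℂ)‖ ≤ k.factorial * A / R ^ k)
    (hjet : ∀ k : ℕ, k < L → iteratedDeriv k h 0 = 0) :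
    ∀ j : ℕ, j ≤ n → ∀ z ∈ closedBall (((j : ℝ) * s : ℝ) : ℂ) (R / 2),
      ‖h z‖ ≤ 3 * 5 ^ j * A * (1 / 2 : ℝ) ^ (L / 2 ^ j) := by
  intro j
  induction j with
  | zero =>
    intro _ z hz
    have hd := hdiff 0 (Nat.zero_le _)
    have hb := hbig 0 (Nat.zero_le _)
    simp only [Nat.cast_zero, zero_mul, ofReal_zero] at hz hd hb
    have hfin0 : ∀ k : ℕ, k < L → ‖iteratedDeriv k h 0‖ ≤ k.factorial * 0 / (R / 4) ^ k := by
      intro k hk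
      rw [hjet k hk, norm_zero]
      simp
    have h1 := norm_le_of_taylor_split hR hd hA le_rfl hb L hfin0 hz
    have h2 : 0 ≤ A * (1 / 2 : ℝ) ^ L := by positivity
    simp only [pow_zero, Nat.div_one, mul_one]
    linarith
  | succ j ih =>
    intro hj z hz
    have hj' : j ≤ n := Nat.le_of_succ_le hj
    have hd : dist ((((j + 1 : ℕ) : ℝ) * s : ℝ) : ℂ) ((((j : ℕ) : ℝ) * s : ℝ) : ℂ) = s := by
      rw [dist_eq_norm, ← Complex.ofReal_sub, Complex.norm_real, Real.norm_eq_abs, Nat.cast_succ,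
        show ((j : ℝ) + 1) * s - (j : ℝ) * s = s by ring, abs_of_nonneg hs0]
    have hε : ∀ w ∈ ball ((((j + 1 : ℕ) : ℝ) * s : ℝ) : ℂ) (R / 4),
        ‖h w‖ ≤ 3 * 5 ^ j * A * (1 / 2 : ℝ) ^ (L / 2 ^ j) := by
      intro w hw
      apply ih hj' w
      rw [mem_closedBall]
      rw [mem_ball] at hw
      calc dist w ((((j : ℕ) : ℝ) * s : ℝ) : ℂ)
          ≤ dist w ((((j + 1 : ℕ) : ℝ) * s : ℝ) : ℂ) +
              dist ((((j + 1 : ℕ) : ℝ) * s : ℝ) : ℂ) ((((j : ℕ) : ℝ) * s : ℝ) : ℂ) := dist_triangle _ _ _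
        _ ≤ R / 4 + s := by rw [hd]; linarith
        _ ≤ R / 2 := by linarith
    have hN : 2 * (L / 2 ^ (j + 1)) ≤ L / 2 ^ j := by
      rw [pow_succ, ← Nat.div_div_eq_div_mul]
      exact Nat.mul_div_le (L / 2 ^ j) 2
    calc ‖h z‖ ≤ 4 * (3 * 5 ^ j * A * (1 / 2 : ℝ) ^ (L / 2 ^ j)) * 2 ^ (L / 2 ^ (j + 1)) +
          2 * A * (1 / 2) ^ (L / 2 ^ (j + 1)) :=
        norm_le_two_radii hR (hdiff (j + 1) hj) hA (hbig (j + 1) hj) hε (L / 2 ^ (j + 1)) hz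
      _ ≤ 3 * 5 ^ (j + 1) * A * (1 / 2) ^ (L / 2 ^ (j + 1)) := chain_step_arith hA j _ _ hN

/-! ## §6 The rate constant and the main theorem -/

/-- The `n`-fold square root `r_n` of `1/2`: `0 < r_n < 1` and `r_n^{2^n} = 1/2`. -/
theorem sqrt_iterate_half (n : ℕ) :
    0 < Real.sqrt^[n] (1 / 2 : ℝ) ∧ Real.sqrt^[n] (1 / 2 : ℝ) < 1 ∧
      (Real.sqrt^[n] (1 / 2 : ℝ)) ^ (2 ^ n) = 1 / 2 := by
  induction n with
  | zero => norm_num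
  | succ n ih =>
    obtain ⟨h0, h1, h2⟩ := ih
    rw [Function.iterate_succ_apply']
    refine ⟨Real.sqrt_pos.mpr h0, ?_, ?_⟩
    · rw [Real.sqrt_lt' one_pos]
      simpa using h1
    · rw [pow_succ, pow_mul', Real.sq_sqrt h0.le, h2]

/-- Exponent bookkeeping: if `0 ≤ r ≤ 1` and `r^q = 1/2` (`q > 0`) then `2^{−⌊L/q⌋} ≤ 2·r^L`. -/
theorem half_pow_div_le {r : ℝ} (hr0 : 0 ≤ r) (hr1 : r ≤ 1) {q : ℕ} (hq : 0 < q)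
    (hrq : r ^ q = 1 / 2) (L : ℕ) : (1 / 2 : ℝ) ^ (L / q) ≤ 2 * r ^ L := by
  have hlt : L < q * (L / q + 1) := Nat.lt_mul_div_succ L hq
  have h1 : r ^ (q * (L / q + 1)) ≤ r ^ L := pow_le_pow_of_le_one hr0 hr1 hlt.le
  have h2 : r ^ (q * (L / q + 1)) = (1 / 2 : ℝ) ^ (L / q) * (1 / 2) := by
    rw [pow_mul, hrq, pow_succ]
  rw [h2] at h1
  linarith

/-- **Corridor transfer** (the registered stub `stub_corridorTransfer` of line `zerofree_corridor`, structure-free):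
for `η, b > 0` there are `C > 0`, `0 ≤ r < 1` such that two functions holomorphic and zero-free on the corridor
`(−η, b+η) × (−η, η)·i`, bounded by `e^M` there, real with real part `≥ e^{−M}` on the axis, whose derivatives
at `0` agree up to order `L`, satisfy `|log f(b) − log g(b)| ≤ C·(M+1)·r^L`.  Here `C = 48·5^n`,
`r = (1/2)^{2^{−n}}`, `n = ⌈8b/η⌉`. -/
theorem corridorTransfer {η b : ℝ} (hη : 0 < η) (hb : 0 < b) :
    ∃ C r : ℝ, 0 < C ∧ 0 ≤ r ∧ r < 1 ∧
      ∀ (L : ℕ) (M : ℝ) (f g : ℂ → ℂ), 0 ≤ M →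
        DifferentiableOn ℂ f {z : ℂ | -η < z.re ∧ z.re < b + η ∧ |z.im| < η} →
        (∀ z ∈ {z : ℂ | -η < z.re ∧ z.re < b + η ∧ |z.im| < η}, f z ≠ 0) →
        (∀ z ∈ {z : ℂ | -η < z.re ∧ z.re < b + η ∧ |z.im| < η}, ‖f z‖ ≤ Real.exp M) →
        (∀ x : ℝ, -η < x → x < b + η → (f x).im = 0 ∧ Real.exp (-M) ≤ (f x).re) →
        DifferentiableOn ℂ g {z : ℂ | -η < z.re ∧ z.re < b + η ∧ |z.im| < η} →
        (∀ z ∈ {z : ℂ | -η < z.re ∧ z.re < b + η ∧ |z.im| < η}, g z ≠ 0) →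
        (∀ z ∈ {z : ℂ | -η < z.re ∧ z.re < b + η ∧ |z.im| < η}, ‖g z‖ ≤ Real.exp M) →
        (∀ x : ℝ, -η < x → x < b + η → (g x).im = 0 ∧ Real.exp (-M) ≤ (g x).re) →
        (∀ k : ℕ, k < L → iteratedDeriv k f 0 = iteratedDeriv k g 0) →
        |Real.log (f b).re - Real.log (g b).re| ≤ C * (M + 1) * r ^ L := by
  -- the constants
  set n : ℕ := ⌈8 * b / η⌉₊ with hn_def
  have hn_pos : 0 < n := Nat.ceil_pos.mpr (by positivity)
  have hn_ge : 8 * b / η ≤ n := Nat.le_ceil _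
  have hn_real_pos : (0 : ℝ) < n := by exact_mod_cast hn_pos
  have hn0 : (n : ℝ) ≠ 0 := hn_real_pos.ne'
  obtain ⟨hr0, hr1, hrq⟩ := sqrt_iterate_half n
  refine ⟨48 * 5 ^ n, Real.sqrt^[n] (1 / 2 : ℝ), by positivity, hr0.le, hr1, ?_⟩
  intro L M f g hM hfd hf0 hfM hfax hgd hg0 hgM hgax hjet
  set U : Set ℂ := {z : ℂ | -η < z.re ∧ z.re < b + η ∧ |z.im| < η} with hU
  -- logarithms
  obtain ⟨ℓf, hℓfd, hℓfe, hℓfM, hℓfax⟩ := exists_log_on_corridor hU hη hb hfd hf0 hfM hfax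
  obtain ⟨ℓg, hℓgd, hℓge, hℓgM, hℓgax⟩ := exists_log_on_corridor hU hη hb hgd hg0 hgM hgax
  -- axis facts for the logarithms
  have haxis : ∀ (F ℓ : ℂ → ℂ),
      (∀ x : ℝ, -η < x → x < b + η → (F x).im = 0 ∧ Real.exp (-M) ≤ (F x).re) →
      (∀ x : ℝ, -η < x → x < b + η → ℓ x = ((Real.log (F x).re : ℝ) : ℂ)) →
      ∀ x : ℝ, 0 ≤ x → x ≤ b → (ℓ x).im = 0 ∧ -M ≤ (ℓ x).re := by
    intro F ℓ hFax hℓax x h1 h2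
    have h1' : -η < x := by linarith
    have h2' : x < b + η := by linarith
    have hpos : 0 < (F x).re := lt_of_lt_of_le (Real.exp_pos _) (hFax x h1' h2').2
    rw [hℓax x h1' h2']
    simp only [ofReal_im, ofReal_re]
    exact ⟨trivial, (Real.le_log_iff_exp_le hpos).mpr (hFax x h1' h2').2⟩
  -- coefficient bounds at the real centres
  have hcoef : ∀ c : ℝ, 0 ≤ c → c ≤ b → DifferentiableOn ℂ (ℓf - ℓg) (ball (c : ℂ) (η / 2)) ∧
      ∀ k : ℕ, ‖iteratedDeriv k (ℓf - ℓg) c‖ ≤ k.factorial * (8 * M) / (η / 2) ^ k :=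
    fun c hc0 hcb => coeff_bounds_sub_log hU hη hM hℓfd hℓgd hℓfM hℓgM (haxis f ℓf hfax hℓfax)
      (haxis g ℓg hgax hℓgax) hc0 hcb
  -- the jets of `h = ℓf - ℓg` vanish to order `L` at `0`
  have hjetH : ∀ k : ℕ, k < L → iteratedDeriv k (ℓf - ℓg) 0 = 0 := by
    rcases Nat.eq_zero_or_pos L with hL | hL
    · intro k hk; omega
    · have h0U : (0 : ℂ) ∈ U := by
        rw [hU]
        simp only [mem_setOf_eq, zero_re, zero_im, abs_zero]
        exact ⟨by linarith, by linarith, hη⟩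
      have hUn : U ∈ 𝓝 (0 : ℂ) := (corridor_isOpen_convex hU).1.mem_nhds h0U
      have hfg0 : f 0 = g 0 := by simpa using hjet 0 hL
      have hℓ0 : ℓf 0 = ℓg 0 := by
        have h1 := hℓfax 0 (by linarith) (by linarith)
        have h2 := hℓgax 0 (by linarith) (by linarith)
        simp only [ofReal_zero] at h1 h2
        rw [h1, h2, hfg0]
      exact iteratedDeriv_sub_eq_zero_of_jets hUn hfd hgd hℓfd hℓgd hℓfe hℓge (hg0 0 h0U) hℓ0 hjet
  -- the chain of discs with centres `j·s`, `s = b/n ≤ η/8`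
  set s : ℝ := b / n with hs_def
  have hs0 : 0 ≤ s := by positivity
  have h8 : 8 * b ≤ (n : ℝ) * η := by
    have := hn_ge
    rwa [div_le_iff₀ hη] at this
  have hsR : s ≤ η / 2 / 4 := by
    rw [hs_def, div_le_iff₀ hn_real_pos]
    linarith
  have hnb : (n : ℝ) * s = b := by
    rw [hs_def]
    field_simp
  have hcent : ∀ j : ℕ, j ≤ n → 0 ≤ (j : ℝ) * s ∧ (j : ℝ) * s ≤ b := by
    intro j hj
    refine ⟨by positivity, ?_⟩
    have hjn : (j : ℝ) ≤ n := by exact_mod_cast hj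
    calc (j : ℝ) * s ≤ n * s := mul_le_mul_of_nonneg_right hjn hs0
      _ = b := hnb
  have hR : (0 : ℝ) < η / 2 := by positivity
  have hA : (0 : ℝ) ≤ 8 * M := by positivity
  have hchain := chain_bound (h := ℓf - ℓg) (L := L) (n := n) hR hs0 hsR hA
    (fun j hj => (hcoef _ (hcent j hj).1 (hcent j hj).2).1)
    (fun j hj => (hcoef _ (hcent j hj).1 (hcent j hj).2).2) hjetH
  have hmemb : (b : ℂ) ∈ closedBall (((n : ℝ) * s : ℝ) : ℂ) (η / 2 / 2) := by
    rw [hnb]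
    exact mem_closedBall_self (by positivity)
  have hfin := hchain n le_rfl (b : ℂ) hmemb
  -- evaluate `h b`
  have hb1 : -η < b := by linarith
  have hb2 : b < b + η := by linarith
  have hval : (ℓf - ℓg) (b : ℂ) = ((Real.log (f b).re - Real.log (g b).re : ℝ) : ℂ) := by
    rw [Pi.sub_apply, hℓfax b hb1 hb2, hℓgax b hb1 hb2, ← Complex.ofReal_sub]
  rw [hval, Complex.norm_real, Real.norm_eq_abs] at hfin
  have hq : 0 < 2 ^ n := pow_pos two_pos n
  have hexp := half_pow_div_le hr0.le hr1.le hq hrq L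
  have hrL : (0 : ℝ) ≤ (Real.sqrt^[n] (1 / 2 : ℝ)) ^ L := pow_nonneg hr0.le L
  calc |Real.log (f b).re - Real.log (g b).re|
      ≤ 3 * 5 ^ n * (8 * M) * (1 / 2 : ℝ) ^ (L / 2 ^ n) := hfin
    _ ≤ 3 * 5 ^ n * (8 * M) * (2 * (Real.sqrt^[n] (1 / 2 : ℝ)) ^ L) :=
        mul_le_mul_of_nonneg_left hexp (by positivity)
    _ = 48 * 5 ^ n * M * (Real.sqrt^[n] (1 / 2 : ℝ)) ^ L := by ring
    _ ≤ 48 * 5 ^ n * (M + 1) * (Real.sqrt^[n] (1 / 2 : ℝ)) ^ L := by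
        apply mul_le_mul_of_nonneg_right _ hrL
        exact mul_le_mul_of_nonneg_left (by linarith) (by positivity)

end Summit.Ventures.CertifiedManyBodySolver.Theorems.TcThermcert1.ZeroFreeCorridor

end
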